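import Literature.Computability.AlgebraicComplexity.QuantumFunctionalsDirectSum
import Literature.Computability.AlgebraicComplexity.QuantumFunctionalsKroneckerFacts
import Literature.Computability.AlgebraicComplexity.QuantumFunctionalsRestrictionProofs
import HarnessLib

/-!
# The quantum functionals are universal spectral points: assembly of CVZ Cor. 3.31

Topic `Literature/Computability/AlgebraicComplexity`; assembly file for the named fact
`ChristandlVranaZuiddam2023_universalSpectralPoint` (`QuantumFunctionals.lean`; Christandl–Vrana–Zuiddam,
*Universal points in the asymptotic spectrum of tensors*, J. Amer. Math. Soc. 36 (2023), Cor. 3.31),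
the conjunction `_unitTensor ∧ _directSum ∧ _kronecker ∧ _restriction_mono` of the four spectral-point
properties of the (lower) quantum functional `F_θ = quantumFunctional θ` (Def. 3.16) on complex
3-tensors, `θ ∈ P([3])`.

## Content (no definitions)

Of the ingredients of Cor. 3.31, the tree PROVES: normalisation `F_θ(⟨r⟩) = r`
(`ChristandlVranaZuiddam2023_unitTensor_holds`, `QuantumFunctionalsProofs.lean`, Ex. 3.18);
super-additivity `F_θ(s ⊕ t) ≥ F_θ(s) + F_θ(t)` (`quantumFunctional_add_le_directSumTensor` =
`ChristandlVranaZuiddam2023_directSum_superadditive_holds`, `QuantumFunctionalsDirectSum.lean`, Lemma 3.22); super-multiplicativity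
(`ChristandlVranaZuiddam2023_kronecker_ge`, `QuantumFunctionalsKronecker.lean`, Lemma 3.23); restriction
monotonicity (`ChristandlVranaZuiddam2023_restriction_mono_holds`, `QuantumFunctionalsRestrictionProofs.lean`,
Lemma 3.20 with Rem. 3.17). What remains are the two inequalities that the source obtains from the
*upper* quantum functional `F^θ` of Def. 3.3 (isotypic projectors of Schur–Weyl duality):

* sub-additivity `F_θ(s ⊕ t) ≤ F_θ(s) + F_θ(t)` — Lemma 3.11 (`F^θ` is sub-additive: semigroup property of
  the Littlewood–Richardson coefficients, Rem. 3.9, Lemma 3.10.2, Lemma 3.12) with Thm. 3.30 (`F^θ = F_θ`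
  on `P_s(B) ⊇ P([3])`, via Thm. 3.24 — Keyl–Werner spectrum estimation and the gentle measurement
  lemma — and the entanglement-polytope characterisation Thm. 3.29);
* sub-multiplicativity `F_θ(s ⊗ t) ≤ F_θ(s) F_θ(t)` — Lemma 3.13 (semigroup property of the Kronecker
  coefficients, Lemma 3.10.1) with Thm. 3.30.

Both are vendored as named facts next to the proved halves:
`ChristandlVranaZuiddam2023_directSum_subadditive` (`QuantumFunctionalsDirectSum.lean`, with
`ChristandlVranaZuiddam2023_directSum_of_subadditive`) and `ChristandlVranaZuiddam2023_kronecker_le`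
(`QuantumFunctionalsKroneckerFacts.lean`, with `ChristandlVranaZuiddam2023_kronecker_of_le`). This file
proves the reduction of Cor. 3.31 to exactly these two facts —
`ChristandlVranaZuiddam2023_universalSpectralPoint_of_halves` and the converse
`ChristandlVranaZuiddam2023_universalSpectralPoint_iff_halves` — and records the unconditional
(proved) part, `ChristandlVranaZuiddam2023_lowerFunctional_superSpectral` (Thm. 3.19.1–4). The next layer
of the decomposition — the upper functional `F^θ` in coordinates with Lemma 3.11, Lemma 3.13 and
Thm. 3.30 as named facts and the reductions to `_directSum_subadditive` / `_kronecker_le` — is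
`QuantumFunctionalsUpper.lean`.

## Source

M. Christandl, P. Vrana, J. Zuiddam, J. Amer. Math. Soc. 36 (2023) 31–79 = arXiv:1709.07851v3:
§1.2 (spectral points), Def. 3.3, Lemma 3.11, 3.13, Def. 3.16, Thm. 3.19, Lemma 3.20–3.23, Thm. 3.24,
Thm. 3.30, Cor. 3.31.
-/

noncomputable section

open scoped BigOperators

namespace Literature.Computability.AlgebraicComplexity

universe u

/-- **CVZ Cor. 3.31 from its two deep halves.** The quantum functionals `F_θ = F^θ`, `θ ∈ P([3])`,
are universal spectral points of complex 3-tensors — i.e. the conjunction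
`ChristandlVranaZuiddam2023_universalSpectralPoint` of normalisation, additivity, multiplicativity and
restriction monotonicity holds — as soon as `F_θ` is (1) sub-additive under `⊕`
(`ChristandlVranaZuiddam2023_directSum_subadditive`; Lemma 3.11 with Thm. 3.30 in the source) and
(2) sub-multiplicative under `⊗` (`ChristandlVranaZuiddam2023_kronecker_le`; Lemma 3.13 with Thm. 3.30).
Everything else is proved in the tree: `ChristandlVranaZuiddam2023_unitTensor_holds` (Thm. 3.19.1),
`quantumFunctional_add_le_directSumTensor` (Thm. 3.19.2, through
`ChristandlVranaZuiddam2023_directSum_of_subadditive`), `ChristandlVranaZuiddam2023_kronecker_ge`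
(Thm. 3.19.3, through `ChristandlVranaZuiddam2023_kronecker_of_le`) and
`ChristandlVranaZuiddam2023_restriction_mono_holds` (Thm. 3.19.4 / Lemma 3.20).
[cite: ChristandlVranaZuiddam2023, Cor. 3.31] -/
theorem ChristandlVranaZuiddam2023_universalSpectralPoint_of_halves
    (h₁ : ChristandlVranaZuiddam2023_directSum_subadditive.{u})
    (h₂ : ChristandlVranaZuiddam2023_kronecker_le.{u}) :
    ChristandlVranaZuiddam2023_universalSpectralPoint.{u} :=
  ⟨ChristandlVranaZuiddam2023_unitTensor_holds, ChristandlVranaZuiddam2023_directSum_of_subadditive h₁,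
    ChristandlVranaZuiddam2023_kronecker_of_le h₂, ChristandlVranaZuiddam2023_restriction_mono_holds⟩

/-- **The reduction is tight**: Cor. 3.31 (`_universalSpectralPoint`) holds iff its two deep halves —
sub-additivity and sub-multiplicativity of `F_θ` — hold. [cite: ChristandlVranaZuiddam2023, Cor. 3.31] -/
theorem ChristandlVranaZuiddam2023_universalSpectralPoint_iff_halves :
    ChristandlVranaZuiddam2023_universalSpectralPoint.{u} ↔
      ChristandlVranaZuiddam2023_directSum_subadditive.{u} ∧ ChristandlVranaZuiddam2023_kronecker_le.{u} :=
  ⟨fun h => ⟨h.directSum.subadditive, h.kronecker.le⟩,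
    fun h => ChristandlVranaZuiddam2023_universalSpectralPoint_of_halves h.1 h.2⟩

/-- **Unconditional part of Cor. 3.31, assembled** (CVZ Thm. 3.19.1–4 for `k = 3`): for every
`θ ∈ P([3])` the quantum functional `F_θ` is normalised on unit tensors, super-additive under `⊕`,
super-multiplicative under `⊗` and monotone under restriction — in the language of §1.1, a
`≥`-monotone normalised map that is super-additive and super-multiplicative, hence a lower bound on
asymptotic rank; the proved half of "`F_θ` is a universal spectral point".
[cite: ChristandlVranaZuiddam2023, Thm. 3.19] -/
theorem ChristandlVranaZuiddam2023_lowerFunctional_superSpectral :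
    ChristandlVranaZuiddam2023_unitTensor ∧ ChristandlVranaZuiddam2023_directSum_superadditive.{u} ∧
    (∀ (θ : Fin 3 → ℝ), θ ∈ stdSimplex ℝ (Fin 3) →
      ∀ {ι κ μ ι' κ' μ' : Type u} [Fintype ι] [Fintype κ] [Fintype μ] [Fintype ι'] [Fintype κ']
        [Fintype μ'] [DecidableEq ι] [DecidableEq κ] [DecidableEq μ] [DecidableEq ι'] [DecidableEq κ']
        [DecidableEq μ'] (s : ι → κ → μ → ℂ) (t : ι' → κ' → μ' → ℂ),
      quantumFunctional θ s * quantumFunctional θ t ≤ quantumFunctional θ (kroneckerTensor s t)) ∧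
    ChristandlVranaZuiddam2023_restriction_mono.{u} :=
  ⟨ChristandlVranaZuiddam2023_unitTensor_holds, ChristandlVranaZuiddam2023_directSum_superadditive_holds,
    fun θ hθ _ _ _ _ _ _ _ _ _ _ _ _ _ _ _ _ _ _ s t => ChristandlVranaZuiddam2023_kronecker_ge θ hθ s t,
    ChristandlVranaZuiddam2023_restriction_mono_holds⟩

/-- A consequence available unconditionally: `F_θ(s ⊕ t) ≥ F_θ(s) + F_θ(t)` and
`F_θ(s ⊗ t) ≥ F_θ(s) F_θ(t)` give `F_θ((s ⊕ t) ⊗ u) ≥ (F_θ(s) + F_θ(t)) F_θ(u)` — the shape in which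
super-additivity and super-multiplicativity enter lower bounds on asymptotic rank (CVZ §1.1).
[cite: ChristandlVranaZuiddam2023, Thm. 3.19] -/
theorem quantumFunctional_directSum_kronecker_ge {θ : Fin 3 → ℝ} (hθ : θ ∈ stdSimplex ℝ (Fin 3))
    {ι κ μ ι' κ' μ' ι'' κ'' μ'' : Type u} [Fintype ι] [Fintype κ] [Fintype μ] [Fintype ι'] [Fintype κ']
    [Fintype μ'] [Fintype ι''] [Fintype κ''] [Fintype μ''] [DecidableEq ι] [DecidableEq κ] [DecidableEq μ]
    [DecidableEq ι'] [DecidableEq κ'] [DecidableEq μ'] [DecidableEq ι''] [DecidableEq κ'']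
    [DecidableEq μ''] (s : ι → κ → μ → ℂ) (t : ι' → κ' → μ' → ℂ) (u : ι'' → κ'' → μ'' → ℂ) :
    (quantumFunctional θ s + quantumFunctional θ t) * quantumFunctional θ u ≤
      quantumFunctional θ (kroneckerTensor (directSumTensor s t) u) :=
  (mul_le_mul_of_nonneg_right (quantumFunctional_add_le_directSumTensor hθ s t)
    (quantumFunctional_nonneg θ u)).trans (ChristandlVranaZuiddam2023_kronecker_ge θ hθ _ u)

end Literature.Computability.AlgebraicComplexity

end
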